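import Mathlib

/-!
# LEMMA H♯ — a weighted Hall condition for monad displays (hsemireg-monad-2 g13, 2026-08-31)

Crux of record: item stmt-HodgeConjecture-18881 (`BlochSeedDiscOne`), LINE `Cruxes/BlochSeedDiscOne/Lines/birth.lean`
814a6a70c14e831a, stub `stub_rung_pad4_seedAt` (positive side: ONE (A1)-clean design with μ ≠ 0 realised by a vector
bundle).  NOTHING in this file proves HC, HC_AV, HC_CM, №4, 26512, 18881 or H2, and the stub is untouched: this is the
kernel-checked linear-algebra core (LEMMA H♯ = the kill inequality; LEMMA P + LEMMA D = nonsingularity of the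
construction's blocks) of the VALUE-LEVEL door test (T2♯) of memo
`Cruxes/BlochSeedDiscOne/VALUELEVEL-v2-CASC-G16-monad2-g13.md`, which kills the three-term (monad) design
casc123c = c9348e400ea21a5d of hsemireg-colour-1 g16 at one point and leaves casc56 / casc48 / casc60 SOLVED.

## Dictionary (memo §3)
At a point `x` of the base, a monad display `V_A --i--> V_N --q--> V_C` (i injective, q surjective, q ∘ i = 0) splits
along letter cells.  For a set `U` of N-cells put `VU = ⊕_{ν ∈ U} V_ν` and `qU = q|VU`; `W = ⊕_{a ∈ A_U} V_a` where
`A_U` = the A-cells ALL of whose alive targets lie in `U` (so `i(W) ⊆ VU`: `iU = i|W`, injective, `qU ∘ iU = 0`);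
`VU0 ⊆ VU` (`j` = inclusion) the cells of `U` that see none of the C-copies `c_ν, ν ∈ D`; `PD` = the coordinate
projection of `V_C` onto `CD = ⊕_{ν ∈ D} V_{c_ν}` and `P0` onto `C0 = ⊕ V_c` over the C-cells whose alive sources all
lie in `U0`.  The hypotheses below are then: `hD` ⟸ (F3♯) `Q_νν` surjective for `ν ∈ D` + pairwise invisibility of
`D`; `h0D` ⟸ definition of `U0`; `h00` ⟸ `q` surjective and every source of `C0` lies in `U0`.  The conclusion is the
mass inequality `m(C_D) + m(C0) + m(A_U) ≤ m(U)` (all `V_*` have dimension = letter multiplicity), violated on casc123c by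
210864 = 377856 + 170688 + 4843776 − 5181456.
-/

set_option linter.dupNamespace false

namespace Summit.HodgeConjecture.HodgeConjecture.Cruxes.BlochSeedDiscOne.MonadHallSharp

open Module

variable {K : Type*} [DivisionRing K]
  {VU VU0 W C CD C0 : Type*}
  [AddCommGroup VU] [Module K VU] [AddCommGroup VU0] [Module K VU0] [AddCommGroup W] [Module K W]
  [AddCommGroup C] [Module K C] [AddCommGroup CD] [Module K CD] [AddCommGroup C0] [Module K C0]

/-- Lower bound for the rank of `qU`: if `PD ∘ qU` is onto `CD`, while the sub-block `qU ∘ j` is killed by `PD`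
but maps onto `C0` under `P0`, then `rank qU ≥ dim CD + dim C0`. -/
theorem finrank_add_finrank_le_finrank_range [FiniteDimensional K VU]
    (qU : VU →ₗ[K] C) (j : VU0 →ₗ[K] VU) (PD : C →ₗ[K] CD) (P0 : C →ₗ[K] C0)
    (hD : Function.Surjective (PD ∘ₗ qU)) (h0D : PD ∘ₗ qU ∘ₗ j = 0)
    (h00 : Function.Surjective (P0 ∘ₗ qU ∘ₗ j)) :
    finrank K CD + finrank K C0 ≤ finrank K (LinearMap.range qU) := by
  classical
  set S : Submodule K C := LinearMap.range qU with hS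
  -- `f` = `PD` restricted to `S`, onto `CD`.
  let f : S →ₗ[K] CD := PD ∘ₗ S.subtype
  have hf : Function.Surjective f := by
    intro y
    obtain ⟨x, hx⟩ := hD y
    refine ⟨⟨qU x, LinearMap.mem_range_self qU x⟩, ?_⟩
    simpa [f] using hx
  have hrange : finrank K (LinearMap.range f) = finrank K CD := by
    rw [LinearMap.range_eq_top.mpr hf, finrank_top]
  -- rank–nullity for `f`
  have hrn : finrank K (LinearMap.range f) + finrank K (LinearMap.ker f) = finrank K S :=
    LinearMap.finrank_range_add_finrank_ker f
  -- `S0` = the image of the `U0`-block, a subspace of `S` killed by `PD` and of dimension ≥ dim C0.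
  set S0 : Submodule K C := LinearMap.range (qU ∘ₗ j) with hS0
  have hS0S : S0 ≤ S := by
    rw [hS0, hS]; exact LinearMap.range_comp_le_range j qU
  have hC0 : finrank K C0 ≤ finrank K S0 := by
    have h1 : Submodule.map P0 S0 = ⊤ := by
      rw [hS0, ← LinearMap.range_comp]
      exact LinearMap.range_eq_top.mpr (by simpa [LinearMap.comp_assoc] using h00)
    haveI : FiniteDimensional K S0 := Submodule.finiteDimensional_of_le hS0S
    have h2 : finrank K (Submodule.map P0 S0) ≤ finrank K S0 := Submodule.finrank_map_le P0 S0
    rwa [h1, finrank_top] at h2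
  -- transport `S0` into `S` and compare with `ker f`
  let T : Submodule K S := Submodule.comap S.subtype S0
  have hT : finrank K T = finrank K S0 := LinearEquiv.finrank_eq (Submodule.comapSubtypeEquivOfLe hS0S)
  have hTker : T ≤ LinearMap.ker f := by
    intro s hs
    have hs' : (s : C) ∈ S0 := hs
    rw [hS0, LinearMap.mem_range] at hs'
    obtain ⟨z, hz⟩ := hs'
    rw [LinearMap.mem_ker]
    have : (PD ∘ₗ qU ∘ₗ j) z = 0 := by rw [h0D]; rfl
    simp only [LinearMap.coe_comp, Function.comp_apply] at this hz
    show PD (s : C) = 0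
    rw [← hz]; exact this
  have hker : finrank K S0 ≤ finrank K (LinearMap.ker f) := by
    rw [← hT]; exact Submodule.finrank_mono hTker
  omega

/-- **LEMMA H♯.**  In the dictionary of the module docstring: `m(C_D) + m(C_0) + m(A_U) ≤ m(U)` for every value-level
solution of the monad template. -/
theorem hallSharp [FiniteDimensional K VU]
    (qU : VU →ₗ[K] C) (iU : W →ₗ[K] VU) (j : VU0 →ₗ[K] VU) (PD : C →ₗ[K] CD) (P0 : C →ₗ[K] C0)
    (hi : Function.Injective iU) (hqi : qU ∘ₗ iU = 0)
    (hD : Function.Surjective (PD ∘ₗ qU)) (h0D : PD ∘ₗ qU ∘ₗ j = 0)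
    (h00 : Function.Surjective (P0 ∘ₗ qU ∘ₗ j)) :
    finrank K CD + finrank K C0 + finrank K W ≤ finrank K VU := by
  have h1 := finrank_add_finrank_le_finrank_range qU j PD P0 hD h0D h00
  have hrn : finrank K (LinearMap.range qU) + finrank K (LinearMap.ker qU) = finrank K VU :=
    LinearMap.finrank_range_add_finrank_ker qU
  have hW : finrank K W ≤ finrank K (LinearMap.ker qU) := by
    have hle : LinearMap.range iU ≤ LinearMap.ker qU := by
      rintro _ ⟨w, rfl⟩
      rw [LinearMap.mem_ker]
      have := congrArg (fun g => g w) hqi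
      simpa using this
    rw [← LinearMap.finrank_range_of_inj hi]
    exact Submodule.finrank_mono hle
  omega

/-- LEMMA D of the memo (the anchor rows of scheme v2 are strictly diagonally dominant: `|7| > legs + echo ≤ 5`,
hence `i` is injective) is Mathlib's Levy–Desplanques theorem, recorded here by name for the dictionary. -/
theorem lemmaD {n : Type*} [Fintype n] [DecidableEq n] {M : Matrix n n ℚ}
    (h : ∀ k, ∑ j ∈ Finset.univ.erase k, ‖M k j‖ < ‖M k k‖) : M.det ≠ 0 :=
  det_ne_zero_of_sum_row_lt_diag h

/-- The numerical instance that kills casc123c (memo §3): the four masses of the certificate violate H♯. -/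
theorem casc123c_masses_violate : ¬ (377856 + 170688 + 4843776 ≤ (5181456 : ℕ)) := by norm_num

/-! ## LEMMA P (construction side, memo §3)

The square blocks cut out of the scheme-v2 matrix `i(x)` by a forced row — (F1) legs `= 1` on a bijection
slots ↔ units plus anchors `= c`, (F2) echo bijection plus anchors, (F3♯) echo rows plus anchors — all have the
shape `anchorMatrix e a c`: slot `s` carries coefficient `1` in the column `e s` and, if `a s = some u`, coefficient
`c` in the column `u` (the unit anchored at `s`).  For `|c| > 1` such a matrix is nonsingular (no column
exclusivity of the anchors is even needed): a kernel vector `v` satisfies `v (e s) = −c · v u`, and the unit of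
smallest nonzero `|v|` gives the contradiction `|v u| = |v (e s)| / |c| < |v (e s)|`. -/

section LemmaP

open Matrix

variable {n : Type*} [Fintype n] [DecidableEq n] {F : Type*} [Field F] [LinearOrder F] [IsStrictOrderedRing F]

/-- Legs/echo on the bijection `e` (coefficient 1) plus anchors `a` (coefficient `c`). -/
def anchorMatrix (e : Equiv.Perm n) (a : n → Option n) (c : F) : Matrix n n F :=
  Matrix.of fun s u => (if u = e s then (1 : F) else 0) + (if a s = some u then c else 0)

omit [LinearOrder F] [IsStrictOrderedRing F] in
theorem anchorMatrix_mulVec (e : Equiv.Perm n) (a : n → Option n) (c : F) (v : n → F) (s : n) :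
    (anchorMatrix e a c *ᵥ v) s = v (e s) + (a s).elim 0 (fun u => c * v u) := by
  unfold anchorMatrix
  simp only [Matrix.mulVec, dotProduct, Matrix.of_apply, add_mul, Finset.sum_add_distrib]
  congr 1
  · simp [ite_mul]
  · cases h : a s with
    | none => simp
    | some u0 =>
      simp only [Option.some.injEq, Option.elim_some, ite_mul, zero_mul]
      rw [Finset.sum_ite_eq]; simp

/-- **LEMMA P.** `det (anchorMatrix e a c) ≠ 0` whenever `1 < |c|` (the scheme uses `c = 7`). -/
theorem lemmaP (e : Equiv.Perm n) (a : n → Option n) {c : F} (hc : 1 < |c|) :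
    (anchorMatrix e a c).det ≠ 0 := by
  intro hdet
  obtain ⟨v, hv0, hv⟩ := Matrix.exists_mulVec_eq_zero_iff.mpr hdet
  have hT : (Finset.univ.filter fun i => v i ≠ 0).Nonempty := by
    by_contra hne
    apply hv0
    funext i
    rw [Finset.not_nonempty_iff_eq_empty, Finset.filter_eq_empty_iff] at hne
    have := hne (Finset.mem_univ i)
    simpa using this
  obtain ⟨i, hi, hmin⟩ := Finset.exists_min_image _ (fun i => |v i|) hT
  have hvi : v i ≠ 0 := by simpa using hi
  have hcpos : (0 : F) < |c| := lt_trans zero_lt_one hc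
  have hc0 : c ≠ 0 := abs_pos.mp hcpos
  have row := congrFun hv (e.symm i)
  rw [anchorMatrix_mulVec] at row
  simp only [Equiv.apply_symm_apply, Pi.zero_apply] at row
  cases h : a (e.symm i) with
  | none =>
    rw [h] at row
    simp only [Option.elim_none, add_zero] at row
    exact hvi row
  | some u =>
    rw [h] at row
    simp only [Option.elim_some] at row
    -- row : v i + c * v u = 0
    have hvu : v u = -(v i) / c := by
      field_simp
      linear_combination row
    have hvu0 : v u ≠ 0 := by
      rw [hvu]; exact div_ne_zero (neg_ne_zero.mpr hvi) hc0
    have hlt : |v u| < |v i| := by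
      rw [hvu, abs_div, abs_neg, div_lt_iff₀ hcpos]
      have hvipos : 0 < |v i| := abs_pos.mpr hvi
      nlinarith
    have hle := hmin u (by simpa using hvu0)
    exact absurd hle (not_le.mpr hlt)

/-- The scheme's coefficient. -/
example : (1 : ℚ) < |(7 : ℚ)| := by norm_num

end LemmaP

end Summit.HodgeConjecture.HodgeConjecture.Cruxes.BlochSeedDiscOne.MonadHallSharp
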